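import Summits.HubbardSuperconductivity.HubbardSuperconductivity.Theorems.AnisotropyChordEnergyConvexOfLogConcave
import Summits.AtomisticToContinuum.BoseEinsteinCondensation.Theorems.InsertionFieldDelocalisation.Negative.PerronExistence

/-!
# Route `AnisotropyChord`: `XXZSectorHeatAmplitudeLogConcave → XXZSectorEnergyConvex` on EVERY finite
# graph — the theory seat's PORT-SPEC §76 P-7b implication, PROVED verbatim

`…EnergyConvexOfLogConcave` proved the implication «heat-amplitude log-concavity ⇒ convexity of the
sector energies `2E(M) ≤ E(M−1) + E(M+1)`» on CONNECTED graphs (it used the strictly positive Perron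
vector of a sector).  Connectedness is not needed: the heat-kernel rate lemma
`heatKernelRate_of_groundOverlap` only wants SOME sector ground vector `w` with `⟨w, 𝟙_W⟩ ≠ 0`, and on
any graph every non-empty weight sector of `H(Δ) = xxzHamiltonian 1 G (−1) Δ` carries a non-zero
entrywise NON-NEGATIVE ground vector (`xxz_exists_nonneg_sectorGroundState`: `H(Δ)` has real entries,
non-positive off the diagonal; take a real sector eigenvector `s` at the sector energy and pass to `|s|`,
which does not raise the Rayleigh quotient, then use the variational principle on the invariant sector —
the reducible Perron–Frobenius argument of `…InsertionFieldDelocalisation.Negative.PerronExistence`,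
there written for `Δ = 0`).  Hence `heatRate_sector_allGraphs` and the literal implication

  `xxzSectorEnergyConvex_of_logConcave : XXZSectorHeatAmplitudeLogConcave → XXZSectorEnergyConvex`.

So E-CONV (memo ROTOR-THEORY-6 §67) is, in the tree, EXACTLY as conditional as the finite-`t`
log-concavity statement (Borcea–Brändén layer, PORT-SPEC §71/§76 P-8); nothing else is pending.
Theory seat `hubbard-h0-rotor-theory-1`; no definition is introduced.
-/

set_option linter.dupNamespace false

noncomputable section

namespace Summit.HubbardSuperconductivity.HubbardSuperconductivity.Theorems.AnisotropyChord

open Matrix Complex Finset Filter Topology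
open scoped ComplexOrder
open Literature.MathematicalPhysics.QuantumLattice Literature.Probability.LatticeModels
open Summit.AtomisticToContinuum.BoseEinsteinCondensation.Theorems.InsertionFieldDelocalisation.Negative
  (mulVec_eq_smul_of_energy_le_on)

section Helpers

variable {V : Type*} [Fintype V] [DecidableEq V]

/-- The entries of `H(Δ) = xxzHamiltonian 1 G (−1) Δ` are real and non-positive off the diagonal
(`leadPF_entries` with zero fields). [folklore] -/
theorem xxz_entries_real_offdiag_nonpos (G : SimpleGraph V) [DecidableRel G.Adj] (Δ : ℝ) :
    (∀ σ τ : V → Fin 2, star (xxzHamiltonian 1 G (-1) Δ σ τ) = xxzHamiltonian 1 G (-1) Δ σ τ) ∧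
    (∀ σ τ : V → Fin 2, σ ≠ τ → (xxzHamiltonian 1 G (-1) Δ σ τ).re ≤ 0) := by
  have hent :=
    Summit.AtomisticToContinuum.BoseEinsteinCondensation.Cruxes.GroundStateStability.StableConeVariationalSelection.leadPF_entries
      G Δ (fun _ => (0 : ℝ))
  simp only [Complex.ofReal_zero, zero_smul, Finset.sum_const_zero, add_zero] at hent
  exact ⟨hent.2.1, hent.2.2.2.1⟩

/-- **Reducible Perron–Frobenius in a weight sector, any graph and any `Δ`.** Every non-empty weight
sector `W` of `H(Δ)` contains a non-zero entrywise real non-negative vector `ψ` with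
`H(Δ) ψ = E_W ψ`, `E_W = lowestEnergyInSector` at `|V|/2 − W`. (Real sector eigenvector, then `|·|`,
which does not raise the Rayleigh quotient; variational principle on the invariant sector.)  Adapted from
`…InsertionFieldDelocalisation.Negative.exists_nonneg_sectorGroundState` (`Δ = 0`). [folklore] -/
theorem xxz_exists_nonneg_sectorGroundState (G : SimpleGraph V) [DecidableRel G.Adj] (Δ : ℝ) (W : ℕ)
    (hW : ∃ σ : V → Fin 2, (∑ z, (σ z : ℕ)) = W) :
    ∃ ψ : (V → Fin 2) → ℂ, ψ ≠ 0 ∧ (∀ σ, 0 ≤ (ψ σ).re ∧ (ψ σ).im = 0) ∧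
      ψ ∈ spinZSector (Λ := V) 1 (((Fintype.card V * 1 : ℕ) : ℝ) / 2 - W) ∧
      xxzHamiltonian 1 G (-1) Δ *ᵥ ψ =
        ((lowestEnergyInSector 1 (xxzHamiltonian 1 G (-1) Δ)
          (((Fintype.card V * 1 : ℕ) : ℝ) / 2 - W) : ℝ) : ℂ) • ψ := by
  set H := xxzHamiltonian 1 G (-1) Δ with hHdef
  have hH : H.IsHermitian := xxzHamiltonian_isHermitian 1 G (-1) Δ
  set K := spinZSector (Λ := V) 1 (((Fintype.card V * 1 : ℕ) : ℝ) / 2 - W) with hKdef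
  have hK : ∀ v, v ∈ K ↔ ∀ σ, ¬(∑ z, (σ z : ℕ)) = W → v σ = 0 :=
    fun v => LiebMattis.mem_spinZSector_weight_iff 1 W v
  have hKinv : ∀ u ∈ K, H *ᵥ u ∈ K := fun u hu => xxz_mulVec_mem_weightSector G Δ W hu
  have hKne : K ≠ ⊥ := by
    obtain ⟨σ₀, hσ₀⟩ := hW
    rw [Submodule.ne_bot_iff]
    refine ⟨fun σ => if (∑ z, (σ z : ℕ)) = W then (1 : ℂ) else 0, (hK _).2 fun σ hσ => if_neg hσ, ?_⟩
    intro h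
    have h1 := congrFun h σ₀
    rw [Pi.zero_apply, if_pos hσ₀] at h1
    exact one_ne_zero h1
  obtain ⟨v, hvK, hv1, hHv⟩ := exists_unit_eigen_minEnergyOn hH K hKinv hKne
  set E : ℝ := H.minEnergyOn K with hEdef
  have hv0 : v ≠ 0 := by
    intro h
    rw [h, dotProduct_zero] at hv1
    exact zero_ne_one hv1
  obtain ⟨hreal, hoff⟩ := xxz_entries_real_offdiag_nonpos G Δ
  -- a nonzero REAL eigenvector in the sector
  obtain ⟨s, hs0, hsK, hs⟩ : ∃ s : (V → Fin 2) → ℝ, s ≠ 0 ∧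
      (∀ σ, ¬(∑ z, (σ z : ℕ)) = W → s σ = 0) ∧
      (H *ᵥ fun j => ((s j : ℝ) : ℂ)) = (E : ℂ) • fun j => ((s j : ℝ) : ℂ) := by
    by_cases hre : (fun j => (v j).re) = 0
    · refine ⟨fun j => (v j).im, ?_, ?_, PerronFrobenius.mulVec_im_eq_smul hreal hHv⟩
      · intro him
        apply hv0
        funext j
        exact Complex.ext (congrFun hre j) (congrFun him j)
      · intro σ hσ
        show (v σ).im = 0
        rw [(hK v).1 hvK σ hσ, Complex.zero_im]
    · refine ⟨fun j => (v j).re, hre, ?_, PerronFrobenius.mulVec_re_eq_smul hreal hHv⟩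
      intro σ hσ
      show (v σ).re = 0
      rw [(hK v).1 hvK σ hσ, Complex.zero_re]
  -- its modulus
  set a : (V → Fin 2) → ℝ := fun j => |s j| with hadef
  have haK : (fun j => ((a j : ℝ) : ℂ)) ∈ K :=
    (hK _).2 fun σ hσ => by simp [hadef, hsK σ hσ]
  have hEa : (star (fun j => ((a j : ℝ) : ℂ)) ⬝ᵥ H *ᵥ fun j => ((a j : ℝ) : ℂ)).re ≤
      E * (star (fun j => ((a j : ℝ) : ℂ)) ⬝ᵥ fun j => ((a j : ℝ) : ℂ)).re := by
    rw [PerronFrobenius.re_star_dotProduct_mulVec_real, PerronFrobenius.re_star_dotProduct_self_real]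
    have h1 : (star (fun j => ((s j : ℝ) : ℂ)) ⬝ᵥ H *ᵥ fun j => ((s j : ℝ) : ℂ)).re =
        E * ∑ i, s i * s i := by
      rw [hs, dotProduct_smul, smul_eq_mul, Complex.re_ofReal_mul,
        PerronFrobenius.re_star_dotProduct_self_real]
    calc ∑ i, ∑ j, (H i j).re * (|s i| * |s j|)
        ≤ ∑ i, ∑ j, (H i j).re * (s i * s j) := PerronFrobenius.sum_abs_mul_abs_le hoff s
      _ = E * ∑ i, s i * s i := by rw [← PerronFrobenius.re_star_dotProduct_mulVec_real, h1]
      _ = E * ∑ i, |s i| * |s i| := by simp only [abs_mul_abs_self]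
  have hEK : ∀ u ∈ K, E * (star u ⬝ᵥ u).re ≤ (star u ⬝ᵥ H *ᵥ u).re := fun u hu =>
    minEnergyOn_mul_le_re_rayleigh hH K hu
  have hHa := mulVec_eq_smul_of_energy_le_on hH.eq K hKinv hEK haK hEa
  refine ⟨fun j => ((a j : ℝ) : ℂ), ?_, ?_, haK, hHa⟩
  · obtain ⟨i, hi⟩ := Function.ne_iff.mp hs0
    refine Function.ne_iff.mpr ⟨i, ?_⟩
    show ((a i : ℝ) : ℂ) ≠ 0
    exact_mod_cast abs_ne_zero.mpr hi
  · intro σ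
    simp [hadef, abs_nonneg]

/-- **The heat-kernel rate of a sector indicator is the sector energy — ANY graph** (weight `W`
attained): `c_W(t) = Re⟨𝟙_W, e^{−tH} 𝟙_W⟩ > 0` for `t ≥ 0` and `−t⁻¹ log c_W(t) → E_W`.  As
`heatRate_sector`, with the non-negative ground vector of `xxz_exists_nonneg_sectorGroundState` in place
of the Perron vector of a connected graph. [folklore] -/
theorem heatRate_sector_allGraphs (G : SimpleGraph V) [DecidableRel G.Adj] (Δ : ℝ) (W : ℕ)
    (hW : ∃ σ : V → Fin 2, (∑ z, (σ z : ℕ)) = W) :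
    (∀ t : ℝ, 0 ≤ t → 0 < (star (fun σ : V → Fin 2 =>
        if (Finset.univ.filter fun x => σ x = 1).card = W then (1 : ℂ) else 0) ⬝ᵥ
        (NormedSpace.exp (-(t : ℂ) • xxzHamiltonian 1 G (-1) Δ)) *ᵥ
          (fun σ : V → Fin 2 => if (Finset.univ.filter fun x => σ x = 1).card = W then (1 : ℂ) else 0)).re) ∧
    Tendsto (fun t : ℝ => -Real.log ((star (fun σ : V → Fin 2 =>
        if (Finset.univ.filter fun x => σ x = 1).card = W then (1 : ℂ) else 0) ⬝ᵥ
        (NormedSpace.exp (-(t : ℂ) • xxzHamiltonian 1 G (-1) Δ)) *ᵥ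
          (fun σ : V → Fin 2 => if (Finset.univ.filter fun x => σ x = 1).card = W then (1 : ℂ) else 0)).re) / t)
      atTop (𝓝 (lowestEnergyInSector 1 (xxzHamiltonian 1 G (-1) Δ) (((Fintype.card V * 1 : ℕ) : ℝ) / 2 - W))) := by
  set H := xxzHamiltonian 1 G (-1) Δ with hHdef
  have hH : H.IsHermitian := xxzHamiltonian_isHermitian 1 G (-1) Δ
  set K := spinZSector (Λ := V) 1 (((Fintype.card V * 1 : ℕ) : ℝ) / 2 - W) with hKdef
  set ind : (V → Fin 2) → ℂ := fun σ => if (Finset.univ.filter fun x => σ x = 1).card = W then (1 : ℂ) else 0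
    with hind
  have hK : ∀ x ∈ K, H *ᵥ x ∈ K := fun x hx => xxz_mulVec_mem_weightSector G Δ W hx
  set E := lowestEnergyInSector 1 H (((Fintype.card V * 1 : ℕ) : ℝ) / 2 - W) with hEdef
  have hE : ∀ x ∈ K, E * (star x ⬝ᵥ x).re ≤ (star x ⬝ᵥ H *ᵥ x).re :=
    fun x hx => minEnergyOn_mul_le_re_rayleigh hH K hx
  obtain ⟨w, hw0, hwnn, hwK, hHw⟩ := xxz_exists_nonneg_sectorGroundState G Δ W hW
  have hindK : ind ∈ K := by
    rw [hKdef, LiebMattis.mem_spinZSector_weight_iff]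
    intro σ hσ
    rw [hind]
    simp only
    rw [if_neg]
    rw [← weight_eq_card_filter]; exact hσ
  have hind_apply : ∀ σ, ind σ = if (∑ z, (σ z : ℕ)) = W then 1 else 0 := by
    intro σ; simp only [hind, weight_eq_card_filter]
  -- `⟨w, 𝟙_W⟩ ≠ 0`: `w ≥ 0` is non-zero somewhere, necessarily at weight `W`
  have hwv : star w ⬝ᵥ ind ≠ 0 := by
    obtain ⟨σ₀, hσ₀⟩ := Function.ne_iff.mp hw0
    have hWσ₀ : (∑ z, (σ₀ z : ℕ)) = W := by
      by_contra h
      exact hσ₀ ((LiebMattis.mem_spinZSector_weight_iff 1 W w).1 hwK σ₀ h)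
    have hpos : 0 < (w σ₀).re := by
      obtain ⟨hre, him⟩ := hwnn σ₀
      refine lt_of_le_of_ne hre fun h => hσ₀ ?_
      show w σ₀ = 0
      exact Complex.ext h.symm him
    have hsum : star w ⬝ᵥ ind = ∑ σ, star (w σ) * ind σ := rfl
    have hre : (star w ⬝ᵥ ind).re = ∑ σ, (if (∑ z, (σ z : ℕ)) = W then (w σ).re else 0) := by
      rw [hsum, Complex.re_sum]
      refine Finset.sum_congr rfl fun σ _ => ?_
      rw [hind_apply]
      split_ifs with h
      · rw [mul_one, Complex.star_def, Complex.conj_re]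
      · rw [mul_zero, Complex.zero_re]
    intro h0
    have h1 : (star w ⬝ᵥ ind).re = 0 := by rw [h0, Complex.zero_re]
    rw [hre] at h1
    have hle : ∀ σ ∈ (Finset.univ : Finset (V → Fin 2)),
        0 ≤ (if (∑ z, (σ z : ℕ)) = W then (w σ).re else 0) := by
      intro σ _; split_ifs
      · exact (hwnn σ).1
      · exact le_rfl
    have h2 := (Finset.sum_eq_zero_iff_of_nonneg hle).1 h1 σ₀ (Finset.mem_univ _)
    rw [if_pos hWσ₀] at h2
    exact hpos.ne' h2
  exact heatKernelRate_of_groundOverlap H hH K hK E hE w hwK hw0 hHw ind hindK hwv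

end Helpers

/-- **E-CONV from heat-amplitude log-concavity on EVERY finite graph**: assuming
`XXZSectorHeatAmplitudeLogConcave`, for `Δ ∈ [−1,1]`, `2E(M) ≤ E(M−1) + E(M+1)` whenever the three
sectors are non-trivial (no connectedness hypothesis). [folklore] -/
theorem xxzSectorEnergyConvex_allGraphs_of_heatAmplitudeLogConcave
    (hLC : XXZSectorHeatAmplitudeLogConcave) {V : Type} [Fintype V] [DecidableEq V]
    (G : SimpleGraph V) [DecidableRel G.Adj] {Δ : ℝ} (h1 : -1 ≤ Δ) (h2 : Δ ≤ 1)
    (M : ℝ) (hm : spinZSector (Λ := V) 1 (M - 1) ≠ ⊥) (h0 : spinZSector (Λ := V) 1 M ≠ ⊥)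
    (hp : spinZSector (Λ := V) 1 (M + 1) ≠ ⊥) :
    2 * lowestEnergyInSector 1 (xxzHamiltonian 1 G (-1) Δ) M ≤
      lowestEnergyInSector 1 (xxzHamiltonian 1 G (-1) Δ) (M - 1) +
        lowestEnergyInSector 1 (xxzHamiltonian 1 G (-1) Δ) (M + 1) := by
  -- the three weights `W + 1, W, W − 1`
  obtain ⟨W, hW, hMW⟩ := exists_weight_of_sector_ne_bot h0
  obtain ⟨Wp, hWp, hMp⟩ := exists_weight_of_sector_ne_bot hm
  obtain ⟨Wm, hWm, hMm⟩ := exists_weight_of_sector_ne_bot hp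
  have hWp' : Wp = W + 1 := by
    have : (Wp : ℝ) = W + 1 := by linarith
    exact_mod_cast this
  have hWm' : Wm + 1 = W := by
    have : (Wm : ℝ) + 1 = W := by linarith
    exact_mod_cast this
  subst hWp'
  have hW1 : 1 ≤ W := by omega
  have hWc : W + 1 ≤ Fintype.card V := by
    obtain ⟨σ, hσ⟩ := hWp
    rw [← hσ, weight_eq_card_filter]
    calc (Finset.univ.filter fun x => σ x = 1).card ≤ (Finset.univ : Finset V).card := Finset.card_filter_le _ _
      _ = Fintype.card V := Finset.card_univ
  -- the three rates
  obtain ⟨pos₁, rate₁⟩ := heatRate_sector_allGraphs G Δ W hW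
  obtain ⟨pos₀, rate₀⟩ := heatRate_sector_allGraphs G Δ (W + 1) hWp
  obtain ⟨pos₂, rate₂⟩ := heatRate_sector_allGraphs G Δ Wm hWm
  rw [hMp, hMm, hMW]
  refine midpoint_convex_of_logConcave_rates (fun t ht => ⟨pos₀ t ht.le, pos₁ t ht.le, pos₂ t ht.le⟩)
    ?_ rate₀ rate₁ rate₂
  intro t ht
  have key := hLC V G Δ h1 h2 t ht.le W hW1 hWc
  dsimp only at key
  rw [show W - 1 = Wm by omega] at key
  rw [pow_two]
  exact (mul_comm _ _).trans_le key

/-- **PORT-SPEC §76 P-7b, the implication itself, PROVED:** heat-amplitude log-concavity implies E-CONV,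
`XXZSectorHeatAmplitudeLogConcave → XXZSectorEnergyConvex` (both as typed in `…EnergyConvexityDefs`).
Theory seat `hubbard-h0-rotor-theory-1`, memo ROTOR-THEORY-6 §67/§71/§76. [folklore] -/
theorem xxzSectorEnergyConvex_of_logConcave :
    XXZSectorHeatAmplitudeLogConcave → XXZSectorEnergyConvex := by
  intro hLC V _ _ G _ Δ h1 h2 M hm h0 hp
  exact xxzSectorEnergyConvex_allGraphs_of_heatAmplitudeLogConcave hLC G h1 h2 M hm h0 hp

end Summit.HubbardSuperconductivity.HubbardSuperconductivity.Theorems.AnisotropyChord
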